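import Summits.AtomisticToContinuum.HydrodynamicLimit.Theorems.EquilibriumClampedCollisionalWindowLD.Negative.PulseWindow

/-!
# Cradle pulse: left limits at any time of the window (helper file of the refutation of `EquilibriumClampedCollisionalWindowLD`, stmt-AtomisticToContinuum-13733; see `Cruxes/EquilibriumClampedCollisionalWindowLD/Disproof.lean` and the evidence WITNESS.md; no Theses declaration is asserted positively; refuter-cdisprove-stmt-AtomisticToContinuum-13733-0)
-/

noncomputable section

open Real
open scoped InnerProductSpace

namespace Summit.AtomisticToContinuum.HydrodynamicLimit.Theorems

namespace EquilibriumClampedCollisionalWindowLDNegative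

section BlockAll

variable {E : Type*} [NormedAddCommGroup E] [InnerProductSpace ℝ E]

section BlockTrajectory

variable {P : Params} {e : E} {D : BlockData E}

/-! ### Left limits at any time of the window -/

/-- The left-limit velocity of sphere `k` at time `c`: the pre-transfer velocity if `c` is a
transfer time, the velocity itself otherwise. [folklore] -/
def vLft (P : Params) (e : E) (D : BlockData E) (c : ℝ) (k : ℕ) : E := by
  classical
  exact if h : ∃ j, j + 2 ≤ P.K ∧ tHit P e D (j + 1) = c then velL P e D (Classical.choose h) k
    else vel P e D k c

/-- Off the transfer times the left-limit velocity is the velocity. [folklore] -/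
theorem vLft_of_not_jump {c : ℝ} (hc : ∀ j, j + 2 ≤ P.K → tHit P e D (j + 1) ≠ c) (k : ℕ) :
    vLft P e D c k = vel P e D k c := by
  classical
  unfold vLft
  rw [dif_neg]
  rintro ⟨j, hj, hjc⟩
  exact hc j hj hjc

/-- At a transfer time the left-limit velocity is the pre-transfer velocity. [folklore] -/
theorem vLft_of_jump (hP : P.Admissible) (hD : DataOK P e D) {c : ℝ} {j : ℕ} (hj : j + 2 ≤ P.K)
    (hjc : tHit P e D (j + 1) = c) (k : ℕ) : vLft P e D c k = velL P e D j k := by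
  classical
  have h : ∃ j, j + 2 ≤ P.K ∧ tHit P e D (j + 1) = c := ⟨j, hj, hjc⟩
  unfold vLft
  rw [dif_pos h]
  have hspec := Classical.choose_spec h
  have heq : Classical.choose h = j := by
    by_contra hne
    rcases lt_or_gt_of_ne hne with hlt | hgt
    · have := tHit_strictMonoOn hP hD (Nat.succ_lt_succ hlt) (by omega : j + 1 ≤ P.K)
      rw [hspec.2, hjc] at this; exact lt_irrefl _ this
    · have := tHit_strictMonoOn hP hD (Nat.succ_lt_succ hgt) (by omega : Classical.choose h + 1 ≤ P.K)
      rw [hspec.2, hjc] at this; exact lt_irrefl _ this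
  rw [heq]

/-- **Left limits**: just before any time `c` of the window every sphere flies with the constant
velocity `vLft c k` into its position at `c`. [folklore] -/
theorem before_any (hP : P.Admissible) (hD : DataOK P e D) {c : ℝ} (hc0 : 0 < c)
    (hcw : c < tHit P e D (P.K - 1)) :
    ∃ t₀, t₀ < c ∧ ∀ k, k ≤ P.K → ∀ t ∈ Set.Ioo t₀ c,
      vel P e D k t = vLft P e D c k ∧ pos P e D k t = pos P e D k c - (c - t) • vLft P e D c k := by
  classical
  -- the last hit time strictly before `c`
  set j := Nat.findGreatest (fun k => tHit P e D k < c) P.K with hj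
  have hj0 : tHit P e D j < c :=
    Nat.findGreatest_spec (P := fun k => tHit P e D k < c) (Nat.zero_le P.K) (by simpa using hc0)
  have hjK : j ≤ P.K := Nat.findGreatest_le _
  have hj2 : j + 2 ≤ P.K := by
    by_contra hlt; push Not at hlt
    have hKj : P.K - 1 ≤ j := by omega
    have := tHit_mono hP hD hKj hjK
    linarith
  have hmax : ∀ k, j < k → k ≤ P.K → c ≤ tHit P e D k := by
    intro k hjk hk
    by_contra hlt; push Not at hlt
    exact Nat.findGreatest_is_greatest hjk hk hlt
  have hcj1 : c ≤ tHit P e D (j + 1) := hmax (j + 1) (Nat.lt_succ_self j) (by omega)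
  refine ⟨tHit P e D j, hj0, fun k hk t ht => ?_⟩
  rcases hcj1.lt_or_eq with hlt | heq
  · -- no transfer at `c`: free flight on `(t, c]`
    have hnot : ∀ j', j' + 2 ≤ P.K → tHit P e D (j' + 1) ≠ c := by
      intro j' hj' hjc
      have h1 : tHit P e D j < tHit P e D (j' + 1) := by rw [hjc]; exact hj0
      have h2 : tHit P e D (j' + 1) < tHit P e D (j + 1) := by rw [hjc]; exact hlt
      have h3 : j < j' + 1 := by
        by_contra h; push Not at h
        have := tHit_mono hP hD h hjK; linarith
      have h4 : j' + 1 < j + 1 := by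
        by_contra h; push Not at h
        have := tHit_mono hP hD h (by omega : j' + 1 ≤ P.K); linarith
      omega
    rw [vLft_of_not_jump hnot]
    have hC : ∀ c' ∈ jumpTimes P e D, c' ∉ Set.Ioc t c := by
      intro c' hc' hI
      obtain ⟨l, hl1, hl2, rfl⟩ := mem_jumpTimes.1 hc'
      have h3 : j < l := by
        by_contra h; push Not at h
        have := tHit_mono hP hD h hjK; linarith [hI.1, ht.1]
      have h4 : l < j + 1 := by
        by_contra h; push Not at h
        have := tHit_mono hP hD h (by omega : l ≤ P.K); linarith [hI.2]
      omega
    have hff := freeFlight_between hP hD (s := t) (t := c) (by linarith [ht.1, (tHit_nonneg hP hD hjK)])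
      ht.2.le hcw hC hk
    refine ⟨hff.2.symm, ?_⟩
    rw [hff.1, hff.2]; module
  · -- `c` is the transfer time `tHit (j+1)`
    rw [vLft_of_jump hP hD hj2 heq.symm]
    have hb := before_transfer hP hD hj2 hk ht.1 (heq ▸ ht.2)
    rw [← heq] at hb
    exact hb

end BlockTrajectory

end BlockAll

end EquilibriumClampedCollisionalWindowLDNegative

end Summit.AtomisticToContinuum.HydrodynamicLimit.Theorems

end
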